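/-
Copyright (c) 2026. All rights reserved.
Released under Apache 2.0 license as described in the file LICENSE.
Authors: abc-iut cell, wave-3 discharge seat abc-iut-L6-d2 (gen 2) ([AbsTopIII] Def 3.1 (i): the
ISOMORPHISM `log_k̄ : k~ = 𝒪_k̄^×/𝒪_k̄^μ ⥲ k̄` from abc-iut-L4-t2's `GaloisPadicLog` axioms).
-/
import Literature.AnabelianGeometry.AbsoluteAnabelian.MLFGaloisModel
import Mathlib.GroupTheory.Torsion
import Mathlib.GroupTheory.QuotientGroup.Basic
import HarnessLib

/-!
# [AbsTopIII] Def 3.1 (i): `log_k̄` as an isomorphism `k~ := 𝒪_k̄^× / 𝒪_k̄^μ ⥲ (k̄, +)`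

S. Mochizuki, *Topics in absolute anabelian geometry III*, J. Math. Sci. Univ. Tokyo 22 (2015)
[MochizukiAbsTopIII2015], Def 3.1 (i), manuscript p. 66 l. 21–27 (applied in Def 3.1 (iv) pp. 68–69):
"Note that the [`p`-adic, if `k` is of residue characteristic `p`] logarithm determines a
`Π_k`-equivariant isomorphism `log_k̄ : k~ := (𝒪_k̄^×)^pf ⥲ k̄` [where “pf” denotes the perfection …] of
the topological group `k~` onto the additive topological group `k̄`" — paraphrase: for the DIVISIBLE
group `𝒪_k̄^×` the perfection `(𝒪_k̄^×)^pf` is the quotient `𝒪_k̄^× / 𝒪_k̄^μ` by the roots of unity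
(cf. [IUTchII] Ex 1.8 (iv) `O^{×μ}`, and [IUTchIII] Def 1.1 (i), kurims p. 23: `Ψ~_{†F_v} := (Ψ^×_{†F_v})^pf`).

abc-iut-L4-t2 typed `log_k̄` as the hypothesis structure `GaloisPadicLog k K` (`MLFGaloisModel.lean`)
whose four fields say, in words, "the induced map on `𝒪_k̄^×/μ` is a `G_k`-equivariant bijection onto
`k̄`". THIS FILE turns those words into the kernel object (from the four axioms ALONE, for any
`L : GaloisPadicLog k K`; no analysis):

* `unitGroup k K` — `𝒪_k̄^×` as a subgroup of `k̄^×` (= `unitSubmonoid k K`, which is a group);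
* `GaloisPadicLog.logHom L : 𝒪_k̄^× →* Multiplicative k̄`, with `ker = 𝒪_k̄^μ` (the torsion subgroup,
  `logHom_ker_eq_torsion`) and surjective (`logHom_surjective`);
* `GaloisPadicLog.logEquiv L : 𝒪_k̄^× ⧸ 𝒪_k̄^μ ≃* Multiplicative k̄` — **`log_k̄ : k~ ⥲ k̄`**, with
  `logEquiv_mk`, and its `G_k`-EQUIVARIANCE `logEquiv_map_galois` (`G_k` acts on `𝒪_k̄^×` through
  `k̄^×`, `unitGroup_map_galois_mem`);
* `k~` IS PERFECT: on `𝒪_k̄^× ⧸ 𝒪_k̄^μ` every `n`-th power map (`n ≥ 1`) is bijective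
  (`pow_bijective_unitsModTorsion`, transported from unique divisibility of `(k̄, +)` in
  characteristic `0`) — so the quotient is the perfection in the sense of [FrdI] §0.

This is the model-side form of the carrier change `O^{×μ}(G) = O^×(G)/O^μ(G)` ↔ additive log-shell
ambient module asked for in plan/L6/MERGE-MAP.md §8 B9 (c) ([IUTchII] Ex 1.8 (iv), abc-iut-L6-t1's
`AbsTopMonoids.Oxmu`). Unconditional instances of `L`: `GaloisPadicLog.ofPadicAlgCl` (abc-iut-L3-t11,
`k = ℚ_p`), `GaloisPadicLog.ofPadicSubfield` / `MLFClosure.galoisPadicLog` (this seat). HONEST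
FRAMING: pure algebra over a refereed definition; nothing here bears on [IUTchIII] Cor. 3.12;
typed ≠ discharged.
-/

set_option autoImplicit false

noncomputable section

namespace Literature.AnabelianGeometry.AbsoluteAnabelian

open scoped ValuativeRel

universe u

variable {k : Type u} [Field k] [ValuativeRel k] {K : Type u} [Field K] [Algebra k K]

/-! ## `𝒪_k̄^×` as a group -/

/-- An element of `𝒪_k̄^×` is non-zero. [cite: MochizukiAbsTopIII2015, Definition 3.1 (i) p.66] -/
theorem ne_zero_of_mem_unitSubmonoid {x : K} (hx : x ∈ unitSubmonoid k K) : x ≠ 0 := fun h => by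
  obtain ⟨-, y, -, hxy⟩ := hx
  exact zero_ne_one ((zero_mul y).symm.trans (h ▸ hxy))

/-- The field inverse of an element of `𝒪_k̄^×` lies in `𝒪_k̄^×`.
[cite: MochizukiAbsTopIII2015, Definition 3.1 (i) p.66] -/
theorem inv_mem_unitSubmonoid {x : K} (hx : x ∈ unitSubmonoid k K) : x⁻¹ ∈ unitSubmonoid k K := by
  have hx0 : x ≠ 0 := ne_zero_of_mem_unitSubmonoid hx
  obtain ⟨hxO, y, hyO, hxy⟩ := hx
  have hy : y = x⁻¹ := eq_inv_of_mul_eq_one_right hxy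
  subst hy
  exact ⟨hyO, x, hxO, inv_mul_cancel₀ hx0⟩

variable (k K) in
/-- **`𝒪_k̄^×` as a subgroup of `k̄^×`**: the units of `k̄` whose value lies in abc-iut-L4-t2's
`unitSubmonoid k K` (closed under inverses by `inv_mem_unitSubmonoid`).
[cite: MochizukiAbsTopIII2015, Definition 3.1 (i) p.66] -/
def unitGroup : Subgroup Kˣ where
  carrier := {u | (u : K) ∈ unitSubmonoid k K}
  one_mem' := (unitSubmonoid k K).one_mem
  mul_mem' {u v} hu hv := by
    change ((u * v : Kˣ) : K) ∈ unitSubmonoid k K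
    rw [Units.val_mul]
    exact (unitSubmonoid k K).mul_mem hu hv
  inv_mem' {u} hu := by
    change ((u⁻¹ : Kˣ) : K) ∈ unitSubmonoid k K
    rw [Units.val_inv_eq_inv_val]
    exact inv_mem_unitSubmonoid hu

/-- Membership in `unitGroup`. [cite: MochizukiAbsTopIII2015, Definition 3.1 (i) p.66] -/
theorem mem_unitGroup_iff (u : Kˣ) : u ∈ unitGroup k K ↔ (u : K) ∈ unitSubmonoid k K := Iff.rfl

/-- Every element of `𝒪_k̄^×` (as a subset of `k̄`) is the value of an element of `unitGroup`.
[cite: MochizukiAbsTopIII2015, Definition 3.1 (i) p.66] -/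
theorem exists_unitGroup_val_eq {x : K} (hx : x ∈ unitSubmonoid k K) :
    ∃ u : unitGroup k K, ((u : Kˣ) : K) = x :=
  ⟨⟨Units.mk0 x (ne_zero_of_mem_unitSubmonoid hx), hx⟩, rfl⟩

/-- `G_k` acts on `𝒪_k̄^×` through `k̄^×`: for `σ ∈ Gal(k̄/k)` and `u ∈ 𝒪_k̄^×`, `σ(u) ∈ 𝒪_k̄^×`.
[cite: MochizukiAbsTopIII2015, Definition 3.1 (i) p.66] -/
theorem unitGroup_map_galois_mem (σ : K ≃ₐ[k] K) {u : Kˣ} (hu : u ∈ unitGroup k K) :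
    Units.map (σ : K →* K) u ∈ unitGroup k K := by
  rw [mem_unitGroup_iff, Units.coe_map]
  exact smul_mem_unitSubmonoid σ hu

/-- A unit of `𝒪_k̄` has finite order iff its value does: `u ∈ 𝒪_k̄^μ ↔ ∃ n > 0, (u : k̄)^n = 1`.
[cite: MochizukiAbsTopIII2015, Definition 3.1 (i) p.66] -/
theorem isOfFinOrder_unitGroup_iff (u : unitGroup k K) :
    IsOfFinOrder u ↔ ∃ n : ℕ, 0 < n ∧ ((u : Kˣ) : K) ^ n = 1 := by
  rw [isOfFinOrder_iff_pow_eq_one]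
  refine exists_congr fun n => and_congr_right fun _ => ?_
  rw [← Subtype.coe_inj, Subgroup.coe_pow, Subgroup.coe_one, Units.ext_iff, Units.val_pow_eq_pow_val,
    Units.val_one]

namespace GaloisPadicLog

variable (L : GaloisPadicLog k K)

/-- `log` kills every root of unity of `𝒪_k̄^×` (half of the axiom `log_eq_zero_iff`; with `x = 1`,
`n = 1`: `log 1 = 0`). [cite: MochizukiAbsTopIII2015, Definition 3.1 (i) p.66] -/
theorem log_eq_zero_of_pow_eq_one {x : K} (hx : x ∈ unitSubmonoid k K) {n : ℕ} (hn : 0 < n)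
    (h : x ^ n = 1) : L.log x = 0 :=
  (L.log_eq_zero_iff x hx).mpr ⟨n, hn, h⟩

/-- `log (xⁿ) = n · log x` on `𝒪_k̄^×`. [cite: MochizukiAbsTopIII2015, Definition 3.1 (i) p.66] -/
theorem log_pow {x : K} (hx : x ∈ unitSubmonoid k K) (n : ℕ) : L.log (x ^ n) = n • L.log x := by
  induction n with
  | zero =>
    rw [pow_zero, L.log_eq_zero_of_pow_eq_one (unitSubmonoid k K).one_mem one_pos (one_pow 1),
      zero_smul]
  | succ n ih => rw [pow_succ, L.log_mul _ ((unitSubmonoid k K).pow_mem hx n) _ hx, ih, succ_nsmul]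

/-! ## `log_k̄` as a homomorphism `𝒪_k̄^× → (k̄, +)`, its kernel and image -/

/-- **`log_k̄` on the group `𝒪_k̄^×`**, as a monoid homomorphism to `Multiplicative k̄`.
[cite: MochizukiAbsTopIII2015, Definition 3.1 (i) p.66] -/
def logHom : unitGroup k K →* Multiplicative K where
  toFun u := Multiplicative.ofAdd (L.log ((u : Kˣ) : K))
  map_one' := by
    change Multiplicative.ofAdd (L.log ((1 : Kˣ) : K)) = 1
    rw [Units.val_one, L.log_eq_zero_of_pow_eq_one (unitSubmonoid k K).one_mem one_pos (one_pow 1),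
      ofAdd_zero]
  map_mul' u v := by
    change Multiplicative.ofAdd (L.log (((u : Kˣ) * (v : Kˣ) : Kˣ) : K)) = _
    rw [Units.val_mul, L.log_mul _ u.2 _ v.2, ofAdd_add]

/-- Unfolding lemma. [cite: MochizukiAbsTopIII2015, Definition 3.1 (i) p.66] -/
@[simp] theorem logHom_apply (u : unitGroup k K) :
    L.logHom u = Multiplicative.ofAdd (L.log ((u : Kˣ) : K)) := rfl

/-- **The kernel of `log_k̄` on `𝒪_k̄^×` is `𝒪_k̄^μ`**, the torsion subgroup (axiom `log_eq_zero_iff`).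
[cite: MochizukiAbsTopIII2015, Definition 3.1 (i) p.66] -/
theorem logHom_ker_eq_torsion : L.logHom.ker = CommGroup.torsion (unitGroup k K) := by
  ext u
  rw [MonoidHom.mem_ker, CommGroup.mem_torsion, logHom_apply, ← ofAdd_zero, Multiplicative.ofAdd.injective.eq_iff,
    L.log_eq_zero_iff _ u.2, isOfFinOrder_unitGroup_iff]

/-- **`log_k̄ : 𝒪_k̄^× → k̄` is onto** (axiom `log_surjective`). [cite: MochizukiAbsTopIII2015, Definition 3.1 (i) p.66] -/
theorem logHom_surjective : Function.Surjective L.logHom := fun y => by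
  obtain ⟨x, hx, hxy⟩ := L.log_surjective (Multiplicative.toAdd y)
  obtain ⟨u, rfl⟩ := exists_unitGroup_val_eq hx
  exact ⟨u, by rw [logHom_apply, hxy, ofAdd_toAdd]⟩

/-! ## The isomorphism `log_k̄ : k~ = 𝒪_k̄^× / 𝒪_k̄^μ ⥲ k̄` -/

/-- **[AbsTopIII] Def 3.1 (i), kernel form: `log_k̄ : k~ := 𝒪_k̄^×/𝒪_k̄^μ ⥲ (k̄, +)` is a group
ISOMORPHISM** (`k~ = (𝒪_k̄^×)^pf` realised as the quotient by the roots of unity).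
[cite: MochizukiAbsTopIII2015, Definition 3.1 (i) p.66] -/
def logEquiv : unitGroup k K ⧸ CommGroup.torsion (unitGroup k K) ≃* Multiplicative K :=
  (QuotientGroup.quotientMulEquivOfEq L.logHom_ker_eq_torsion.symm).trans
    (QuotientGroup.quotientKerEquivOfSurjective L.logHom L.logHom_surjective)

/-- `log_k̄` on the class of `u ∈ 𝒪_k̄^×` is `log u`. [cite: MochizukiAbsTopIII2015, Definition 3.1 (i) p.66] -/
@[simp] theorem logEquiv_mk (u : unitGroup k K) :
    L.logEquiv (QuotientGroup.mk u) = Multiplicative.ofAdd (L.log ((u : Kˣ) : K)) := rfl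

/-- `log_k̄ : k~ ⥲ k̄` is bijective. [cite: MochizukiAbsTopIII2015, Definition 3.1 (i) p.66] -/
theorem logEquiv_bijective : Function.Bijective L.logEquiv := L.logEquiv.bijective

/-- **`G_k`-equivariance of `log_k̄ : k~ ⥲ k̄`**: for `σ ∈ Gal(k̄/k)` and `u ∈ 𝒪_k̄^×`,
`log_k̄ [σ u] = σ (log_k̄ [u])` (axiom `log_smul`). [cite: MochizukiAbsTopIII2015, Definition 3.1 (i) p.66] -/
theorem logEquiv_map_galois (σ : K ≃ₐ[k] K) (u : unitGroup k K) :
    L.logEquiv (QuotientGroup.mk ⟨Units.map (σ : K →* K) (u : Kˣ), unitGroup_map_galois_mem σ u.2⟩) =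
      Multiplicative.ofAdd (σ (Multiplicative.toAdd (L.logEquiv (QuotientGroup.mk u)))) := by
  rw [logEquiv_mk, logEquiv_mk, toAdd_ofAdd]
  change Multiplicative.ofAdd (L.log (σ ((u : Kˣ) : K))) = _
  have h := L.log_smul σ _ u.2
  rw [AlgEquiv.smul_def, AlgEquiv.smul_def] at h
  rw [h]

/-! ## `k~` is perfect: unique divisibility of `𝒪_k̄^× / 𝒪_k̄^μ` -/

/-- In characteristic `0`, multiplication by `n ≥ 1` on `(k̄, +)` — i.e. the `n`-th power map of
`Multiplicative k̄` — is bijective. [cite: MochizukiAbsTopIII2015, Definition 3.1 (i) p.66] -/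
theorem pow_bijective_multiplicative [CharZero K] {n : ℕ} (hn : 0 < n) :
    Function.Bijective fun y : Multiplicative K => y ^ n := by
  have hn0 : (n : K) ≠ 0 := by exact_mod_cast hn.ne'
  constructor
  · intro a b hab
    have h : n • Multiplicative.toAdd a = n • Multiplicative.toAdd b := by
      rw [← toAdd_pow, ← toAdd_pow]; exact congrArg _ hab
    rw [nsmul_eq_mul, nsmul_eq_mul] at h
    exact Multiplicative.toAdd.injective (mul_left_cancel₀ hn0 h)
  · intro y
    refine ⟨Multiplicative.ofAdd ((n : K)⁻¹ * Multiplicative.toAdd y), ?_⟩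
    change Multiplicative.ofAdd ((n : K)⁻¹ * Multiplicative.toAdd y) ^ n = y
    rw [← ofAdd_nsmul, nsmul_eq_mul, ← mul_assoc, mul_inv_cancel₀ hn0, one_mul, ofAdd_toAdd]

include L in
/-- **`k~ = 𝒪_k̄^×/𝒪_k̄^μ` is perfect**: for every `n ≥ 1` the `n`-th power map of the quotient is
bijective (transported along `log_k̄` from the unique divisibility of `(k̄, +)`), so the quotient by the
roots of unity IS the perfection `(𝒪_k̄^×)^pf` of [FrdI] §0 / [AbsTopIII] Def 3.1 (i).
[cite: MochizukiAbsTopIII2015, Definition 3.1 (i) p.66] -/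
theorem pow_bijective_unitsModTorsion [CharZero K] {n : ℕ} (hn : 0 < n) :
    Function.Bijective fun x : unitGroup k K ⧸ CommGroup.torsion (unitGroup k K) => x ^ n := by
  have hcomm : (fun y : Multiplicative K => y ^ n) ∘ L.logEquiv =
      L.logEquiv ∘ fun x : unitGroup k K ⧸ CommGroup.torsion (unitGroup k K) => x ^ n := by
    ext x
    simp
  have h := (pow_bijective_multiplicative (K := K) hn).comp L.logEquiv.bijective
  rw [hcomm] at h
  exact (Function.Bijective.of_comp_iff' L.logEquiv.bijective _).mp h

include L in
/-- The torsion of `k~ = 𝒪_k̄^×/𝒪_k̄^μ` is trivial (a class of finite order is the class of a root of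
unity). [cite: MochizukiAbsTopIII2015, Definition 3.1 (i) p.66] -/
theorem isOfFinOrder_unitsModTorsion_iff [CharZero K]
    (x : unitGroup k K ⧸ CommGroup.torsion (unitGroup k K)) : IsOfFinOrder x ↔ x = 1 := by
  constructor
  · intro hx
    obtain ⟨n, hn, hxn⟩ := (isOfFinOrder_iff_pow_eq_one).mp hx
    have hinj := (L.pow_bijective_unitsModTorsion hn).1
    exact hinj (by change x ^ n = 1 ^ n; rw [hxn, one_pow])
  · rintro rfl
    exact IsOfFinOrder.one

/-! ## The multiplicative log-shell `ℐ(G) ⊆ 𝒪^{×μ}` under `log_k̄` (appended) -/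

end GaloisPadicLog

open scoped Pointwise

variable (k K) in
/-- The classes in `k~ = 𝒪_k̄^× ⧸ 𝒪_k̄^μ` of the `G_k`-invariant units `(𝒪_k̄^×)^{G_k} = 𝒪_k^×` ([IUTchII] Ex 1.8 (ix) p. 41: "the image of
the `G`-invariants of `O^×(G)` in `O^{×μ}(G)`"; [AbsTopIII] Def 3.1 (iv) p. 69: "the image of the subgroup
`𝒪_k^× = (𝒪_k̄^×)^{Π_k} ⊆ 𝒪_k̄^×` of Galois-invariants of `𝒪_k̄^×`"). [cite: MochizukiAbsTopIII2015, Definition 3.1 (iv) p.69] -/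
def invariantUnitClasses : Set (unitGroup k K ⧸ CommGroup.torsion (unitGroup k K)) :=
  QuotientGroup.mk '' {u : unitGroup k K | ((u : Kˣ) : K) ∈ invariantUnits k K}

variable (k K) in
/-- **The multiplicative log-shell.** [IUTchII] Ex 1.8 (ix), kurims p. 41 l. 51–53: "one may also
construct the log-shell `I(G) ⊆ O^{×μ}(G)` [i.e., `p⁻¹` times the image of the `G`-invariants of `O^×(G)`
in `O^{×μ}(G)` — cf. [AbsTopIII], Proposition 5.8, (ii)]". Paraphrase with a general exponent `n` (print:
`n = p`; [AbsTopIII] Def 5.4 (iii) p. 126 scales the pre-log-shell by `(p*)⁻¹`): the subset of the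
torsion-free group `k~ = 𝒪_k̄^× ⧸ 𝒪_k̄^μ` of classes whose `n`-th power is the class of an invariant unit
(the shape of abc-iut-L6-t1's `AbsTopMonoids.logShell`, plan/L6/MERGE-MAP §8 B9 (c)).
[cite: MochizukiAbsTopIII2015, Definition 3.1 (iv) p.69] -/
def multLogShell (n : ℕ) : Set (unitGroup k K ⧸ CommGroup.torsion (unitGroup k K)) :=
  {y | y ^ n ∈ invariantUnitClasses k K}

/-- Membership in the multiplicative log-shell, unfolded. [cite: MochizukiAbsTopIII2015, Definition 3.1 (iv) p.69] -/
theorem mem_multLogShell_iff (n : ℕ) (y : unitGroup k K ⧸ CommGroup.torsion (unitGroup k K)) :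
    y ∈ multLogShell k K n ↔
      ∃ u : unitGroup k K, ((u : Kˣ) : K) ∈ invariantUnits k K ∧ QuotientGroup.mk u = y ^ n := by
  simp only [multLogShell, invariantUnitClasses, Set.mem_setOf_eq, Set.mem_image]

namespace GaloisPadicLog

variable (L : GaloisPadicLog k K)

/-- **B9 (c): the carrier change takes the multiplicative log-shell to the additive one.** Under
`log_k̄ : k~ ⥲ k̄`, the multiplicative log-shell `{y ∈ 𝒪_k̄^×/𝒪_k̄^μ : yⁿ ∈ image of 𝒪_k^×}` is mapped
onto `n⁻¹ · log_k̄(𝒪_k^×)` — i.e. onto `n⁻¹ ·` (the generating set of) the pre-log-shell of [AbsTopIII]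
Def 3.1 (iv); with `n = p*` this is the additive log-shell `ℐ_k = (p*)⁻¹·log(𝒪_k^×)` of Def 5.4 (iii) /
[IUTchIII] Def 1.1 (i) (`GaloisPadicLogShellBridge.lean` identifies it with abc-iut-L4-t3's `logShell` for
the real logarithm). [cite: MochizukiAbsTopIII2015, Definition 3.1 (iv) p.69] -/
theorem toAdd_logEquiv_image_multLogShell [CharZero K] {n : ℕ} (hn : 0 < n) :
    (fun y => Multiplicative.toAdd (L.logEquiv y)) '' multLogShell k K n =
      (n : K)⁻¹ • (L.log '' invariantUnits k K) := by
  have hn0 : (n : K) ≠ 0 := by exact_mod_cast hn.ne'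
  ext z
  simp only [Set.mem_image, Set.mem_smul_set, smul_eq_mul]
  constructor
  · rintro ⟨y, hy, rfl⟩
    obtain ⟨u, hu, hyu⟩ := (mem_multLogShell_iff n y).mp hy
    refine ⟨L.log ((u : Kˣ) : K), ⟨((u : Kˣ) : K), hu, rfl⟩, ?_⟩
    -- `log (y^n) = n · log y` and `y^n = [u]`
    have h := congrArg (fun w => Multiplicative.toAdd (L.logEquiv w)) hyu
    simp only [logEquiv_mk, toAdd_ofAdd, map_pow, toAdd_pow, nsmul_eq_mul] at h
    rw [h, ← mul_assoc, inv_mul_cancel₀ hn0, one_mul]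
  · rintro ⟨_, ⟨x, hx, rfl⟩, rfl⟩
    obtain ⟨u, rfl⟩ := exists_unitGroup_val_eq hx.1
    refine ⟨L.logEquiv.symm (Multiplicative.ofAdd ((n : K)⁻¹ * L.log ((u : Kˣ) : K))), ?_, ?_⟩
    · rw [mem_multLogShell_iff]
      refine ⟨u, hx, ?_⟩
      apply L.logEquiv.injective
      rw [map_pow, MulEquiv.apply_symm_apply, logEquiv_mk, ← ofAdd_nsmul, nsmul_eq_mul, ← mul_assoc,
        mul_inv_cancel₀ hn0, one_mul]
    · simp only [MulEquiv.apply_symm_apply, toAdd_ofAdd]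

/-- The same with the pre-log-shell itself, when `log_k̄(𝒪_k^×)` is already a subgroup (as it is: the
image of a group under a homomorphism) — here in the inclusion form
`log_k̄(multLogShell n) ⊆ n⁻¹ · preLogShell`. [cite: MochizukiAbsTopIII2015, Definition 3.1 (iv) p.69] -/
theorem toAdd_logEquiv_image_multLogShell_subset [CharZero K] {n : ℕ} (hn : 0 < n) :
    (fun y => Multiplicative.toAdd (L.logEquiv y)) '' multLogShell k K n ⊆
      (n : K)⁻¹ • (L.preLogShell : Set K) := by
  rw [L.toAdd_logEquiv_image_multLogShell hn]
  exact Set.smul_set_mono AddSubgroup.subset_closure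

/-! ## `G_k` acting on `k~ = 𝒪_k̄^× ⧸ 𝒪_k̄^μ`; `log_k̄` is a `G_k`-equivariant isomorphism (appended) -/

end GaloisPadicLog

/-- The action of `σ ∈ G_k = Gal(k̄/k)` on `𝒪_k̄^×`, as a group endomorphism of `unitGroup k K`
(restriction of `Units.map σ`; no instance is declared — explicit homomorphisms only).
[cite: MochizukiAbsTopIII2015, Definition 3.1 (i) p.66] -/
def unitGroupGaloisMap (σ : K ≃ₐ[k] K) : unitGroup k K →* unitGroup k K where
  toFun u := ⟨Units.map (σ : K →* K) (u : Kˣ), unitGroup_map_galois_mem σ u.2⟩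
  map_one' := Subtype.ext (by simp)
  map_mul' u v := Subtype.ext (by simp)

/-- Unfolding lemma. [cite: MochizukiAbsTopIII2015, Definition 3.1 (i) p.66] -/
@[simp] theorem unitGroupGaloisMap_coe (σ : K ≃ₐ[k] K) (u : unitGroup k K) :
    (((unitGroupGaloisMap σ u : unitGroup k K) : Kˣ) : K) = σ ((u : Kˣ) : K) := rfl

/-- `σ ∈ G_k` maps roots of unity to roots of unity: the torsion subgroup `𝒪_k̄^μ` is stable.
[cite: MochizukiAbsTopIII2015, Definition 3.1 (i) p.66] -/
theorem torsion_le_comap_unitGroupGaloisMap (σ : K ≃ₐ[k] K) :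
    CommGroup.torsion (unitGroup k K) ≤ (CommGroup.torsion (unitGroup k K)).comap (unitGroupGaloisMap σ) := by
  intro u hu
  rw [Subgroup.mem_comap, CommGroup.mem_torsion]
  exact (unitGroupGaloisMap σ).isOfFinOrder ((CommGroup.mem_torsion _).mp hu)

/-- **The `G_k`-action on `k~ = 𝒪_k̄^× ⧸ 𝒪_k̄^μ`** ("the `Π_k`-action is the action obtained by composing
with `ε_k`", p. 66): `σ` induces a group endomorphism of the quotient.
[cite: MochizukiAbsTopIII2015, Definition 3.1 (i) p.66] -/
def unitsModTorsionGaloisMap (σ : K ≃ₐ[k] K) :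
    unitGroup k K ⧸ CommGroup.torsion (unitGroup k K) →* unitGroup k K ⧸ CommGroup.torsion (unitGroup k K) :=
  QuotientGroup.map _ _ (unitGroupGaloisMap σ) (torsion_le_comap_unitGroupGaloisMap σ)

/-- The action on the class of a unit `u` is the class of `σ u`. [cite: MochizukiAbsTopIII2015, Definition 3.1 (i) p.66] -/
@[simp] theorem unitsModTorsionGaloisMap_mk (σ : K ≃ₐ[k] K) (u : unitGroup k K) :
    unitsModTorsionGaloisMap σ (QuotientGroup.mk u) = QuotientGroup.mk (unitGroupGaloisMap σ u) :=
  rfl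

namespace GaloisPadicLog

variable (L : GaloisPadicLog k K)

/-- **`log_k̄ : k~ ⥲ k̄` is `G_k`-EQUIVARIANT** (as a commuting square of maps, for EVERY class `x ∈ k~`):
`log_k̄ (σ · x) = σ (log_k̄ x)`. [cite: MochizukiAbsTopIII2015, Definition 3.1 (i) p.66] -/
theorem logEquiv_unitsModTorsionGaloisMap (σ : K ≃ₐ[k] K)
    (x : unitGroup k K ⧸ CommGroup.torsion (unitGroup k K)) :
    L.logEquiv (unitsModTorsionGaloisMap σ x) =
      Multiplicative.ofAdd (σ (Multiplicative.toAdd (L.logEquiv x))) := by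
  induction x using QuotientGroup.induction_on with
  | H u =>
    rw [unitsModTorsionGaloisMap_mk]
    exact L.logEquiv_map_galois σ u

/-- Equivalently: transporting the `G_k`-action along `log_k̄` gives the Galois action on `(k̄, +)`:
`log_k̄ ∘ (σ · −) ∘ log_k̄⁻¹ = σ` on `k̄`. [cite: MochizukiAbsTopIII2015, Definition 3.1 (i) p.66] -/
theorem toAdd_logEquiv_galois_symm (σ : K ≃ₐ[k] K) (z : K) :
    Multiplicative.toAdd (L.logEquiv (unitsModTorsionGaloisMap σ (L.logEquiv.symm (Multiplicative.ofAdd z)))) =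
      σ z := by
  rw [L.logEquiv_unitsModTorsionGaloisMap, MulEquiv.apply_symm_apply, toAdd_ofAdd, toAdd_ofAdd]

end GaloisPadicLog

end Literature.AnabelianGeometry.AbsoluteAnabelian

end
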